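import Summits.FinalStateConjecture.FinalStateConjecture.Theorems.EIHFluxBalanceInertialRecessionVirialCoercivity
import Summits.FinalStateConjecture.FinalStateConjecture.Theorems.EIHFluxBalanceInertialRecessionVirialEnergy

/-!
# Route EIHFluxBalance — crux `InertialRecession`, abstract endgame for general `N`:
# small internal energy forces every member velocity onto the cold velocity

Helper file for the crux `stmt-FinalStateConjecture-10166` (virial route, evidence note
`InertialRecession_endgame_generalN_virial.md`, §2 "K ≍ spread²"). For a finite group with rest masses `Mⱼ > 0` and velocities
`‖vⱼ‖ ≤ k < 1`, kinematic momenta `pⱼ = Mⱼγ(vⱼ)vⱼ`, energies `μⱼ = Mⱼγ(vⱼ)`, totals `E = Σμⱼ`, `P = Σpⱼ`, `M_B = ΣMⱼ`, cold energy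
`S = √(M_B² + ‖P‖²)`, COLD VELOCITY `V̂ = S⁻¹P` and INTERNAL ENERGY `K = E − S`:

* `norm_sub_le_norm_lorentzMomentum_sub` — `‖a − b‖ ≤ ‖γ(a)a − γ(b)b‖` (from the strong monotonicity `inner_lorentzMomentum_sub_ge`).
* `lorentzMomentum_coldVelocity` — `γ(V̂)V̂ = M_B⁻¹P`: the cold momenta `(Mⱼ/M_B)P` of `internalEnergy_ge` are `Mⱼγ(V̂)V̂`.
* `abs_internalEnergy_sub_le` — `K` is 1-Lipschitz in `(E, P)`, so it is conserved (sharp ± 2ζ) on admissible window paths.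
* `mass_mul_norm_sub_coldVelocity_sq_le` — **`Mⱼ‖vⱼ − V̂‖² ≤ 2Γ³·K`** for every member, `Γ = (√(1 − k²))⁻¹`.
  So a group whose (conserved) internal energy is small is COLD: all member velocities are close to the single vector `V̂`,
  which is a function of the conserved cluster 4-momentum only. This is the pointwise half of LEMMA C of the note (the other
  half, `K → 0` for confined groups, is the virial argument).
-/

noncomputable section

set_option linter.dupNamespace false

open Finset

namespace Summit.FinalStateConjecture.FinalStateConjecture.Theorems.SublinearIsFree.Virial

open Literature.Geometry.Lorentzian

/-- `‖a − b‖ ≤ ‖γ(a)a − γ(b)b‖` on the open unit ball (strong monotonicity + Cauchy–Schwarz). [folklore] -/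
theorem norm_sub_le_norm_lorentzMomentum_sub {a b : E3} (ha : ‖a‖ < 1) (hb : ‖b‖ < 1) :
    ‖a - b‖ ≤ ‖(√(1 - ‖a‖ ^ 2))⁻¹ • a - (√(1 - ‖b‖ ^ 2))⁻¹ • b‖ := by
  have h := inner_lorentzMomentum_sub_ge' ha hb
  have hcs := real_inner_le_norm ((√(1 - ‖a‖ ^ 2))⁻¹ • a - (√(1 - ‖b‖ ^ 2))⁻¹ • b) (a - b)
  by_cases h0 : ‖a - b‖ = 0
  · rw [h0]; exact norm_nonneg _
  · have hpos : 0 < ‖a - b‖ := lt_of_le_of_ne (norm_nonneg _) (Ne.symm h0)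
    have : ‖a - b‖ * ‖a - b‖ ≤ ‖(√(1 - ‖a‖ ^ 2))⁻¹ • a - (√(1 - ‖b‖ ^ 2))⁻¹ • b‖ * ‖a - b‖ := by
      rw [← sq]; exact h.trans hcs
    exact le_of_mul_le_mul_right this hpos

/-- The kinematic energy of a member: `√(M² + ‖Mγ(v)v‖²) = Mγ(v)` for `M ≥ 0`, `‖v‖ < 1`. [folklore] -/
theorem sqrt_sq_add_norm_lorentzMomentum {M : ℝ} (hM : 0 ≤ M) {v : E3} (hv : ‖v‖ < 1) :
    √(M ^ 2 + ‖(M * (√(1 - ‖v‖ ^ 2))⁻¹) • v‖ ^ 2) = M * (√(1 - ‖v‖ ^ 2))⁻¹ := by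
  have h1 : 0 < 1 - ‖v‖ ^ 2 := by nlinarith [norm_nonneg v]
  have hs : 0 < √(1 - ‖v‖ ^ 2) := Real.sqrt_pos.mpr h1
  have hγ : 0 < (√(1 - ‖v‖ ^ 2))⁻¹ := inv_pos.mpr hs
  have hsq : (√(1 - ‖v‖ ^ 2)) ^ 2 = 1 - ‖v‖ ^ 2 := Real.sq_sqrt h1.le
  have hkey : M ^ 2 + ‖(M * (√(1 - ‖v‖ ^ 2))⁻¹) • v‖ ^ 2 = (M * (√(1 - ‖v‖ ^ 2))⁻¹) ^ 2 := by
    rw [norm_smul, Real.norm_eq_abs, abs_of_nonneg (mul_nonneg hM hγ.le), mul_pow, mul_pow, inv_pow, hsq]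
    field_simp
    ring
  rw [hkey, Real.sqrt_sq (mul_nonneg hM hγ.le)]

/-- **The cold velocity.** With `S = √(M_B² + ‖P‖²)`, `M_B > 0` and `V̂ = S⁻¹P`: `‖V̂‖ < 1` and `γ(V̂)V̂ = M_B⁻¹P`. [folklore] -/
theorem lorentzMomentum_coldVelocity {MB : ℝ} (hMB : 0 < MB) (P : E3) :
    ‖(√(MB ^ 2 + ‖P‖ ^ 2))⁻¹ • P‖ < 1 ∧
      (√(1 - ‖(√(MB ^ 2 + ‖P‖ ^ 2))⁻¹ • P‖ ^ 2))⁻¹ • ((√(MB ^ 2 + ‖P‖ ^ 2))⁻¹ • P) = MB⁻¹ • P := by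
  set S : ℝ := √(MB ^ 2 + ‖P‖ ^ 2) with hS
  have hS2pos : 0 < MB ^ 2 + ‖P‖ ^ 2 := by positivity
  have hS0 : 0 < S := Real.sqrt_pos.mpr hS2pos
  have hSsq : S ^ 2 = MB ^ 2 + ‖P‖ ^ 2 := Real.sq_sqrt hS2pos.le
  have hnorm : ‖S⁻¹ • P‖ = S⁻¹ * ‖P‖ := by
    rw [norm_smul, norm_inv, Real.norm_eq_abs, abs_of_pos hS0]
  have hlt : ‖S⁻¹ • P‖ < 1 := by
    rw [hnorm, inv_mul_lt_iff₀ hS0, mul_one]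
    nlinarith [norm_nonneg P, hSsq, hS0]
  refine ⟨hlt, ?_⟩
  -- `1 − ‖V̂‖² = M_B²/S²`, so `γ(V̂) = S/M_B`
  have h1 : 1 - ‖S⁻¹ • P‖ ^ 2 = (MB / S) ^ 2 := by
    rw [hnorm, mul_pow, div_pow, inv_pow]
    field_simp
    nlinarith [hSsq]
  have hγ : (√(1 - ‖S⁻¹ • P‖ ^ 2))⁻¹ = S / MB := by
    rw [h1, Real.sqrt_sq (div_pos hMB hS0).le, inv_div]
  rw [hγ, smul_smul, div_mul_eq_mul_div, mul_inv_cancel₀ hS0.ne', one_div]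

/-- **Small internal energy ⇒ cold.** For a finite group (`j ∈ s`) with rest masses `Mᵢ > 0`, velocities `‖vᵢ‖ ≤ k < 1`,
`Γ = (√(1 − k²))⁻¹`, kinematic momenta `pᵢ = Mᵢγ(vᵢ)vᵢ`, `P = Σpᵢ`, `M_B = ΣMᵢ`, cold velocity `V̂ = (√(M_B² + ‖P‖²))⁻¹P` and
internal energy `K = ΣMᵢγ(vᵢ) − √(M_B² + ‖P‖²)`: `Mⱼ‖vⱼ − V̂‖² ≤ 2Γ³K` for every member `j`. [folklore] -/
theorem mass_mul_norm_sub_coldVelocity_sq_le' {ι : Type*} (s : Finset ι) (M : ι → ℝ) (v : ι → E3) {k : ℝ}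
    (hM : ∀ i ∈ s, 0 < M i) (hk0 : 0 ≤ k) (hk1 : k < 1) (hv : ∀ i ∈ s, ‖v i‖ ≤ k) {j : ι} (hj : j ∈ s) :
    M j * ‖v j - (√((∑ i ∈ s, M i) ^ 2 + ‖∑ i ∈ s, (M i * (√(1 - ‖v i‖ ^ 2))⁻¹) • v i‖ ^ 2))⁻¹ •
        ∑ i ∈ s, (M i * (√(1 - ‖v i‖ ^ 2))⁻¹) • v i‖ ^ 2 ≤
      2 * ((√(1 - k ^ 2))⁻¹) ^ 3 *
        (∑ i ∈ s, M i * (√(1 - ‖v i‖ ^ 2))⁻¹ -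
          √((∑ i ∈ s, M i) ^ 2 + ‖∑ i ∈ s, (M i * (√(1 - ‖v i‖ ^ 2))⁻¹) • v i‖ ^ 2)) := by
  classical
  -- notation
  have hs : s.Nonempty := ⟨j, hj⟩
  set γ : ι → ℝ := fun i ↦ (√(1 - ‖v i‖ ^ 2))⁻¹ with hγdef
  set p : ι → E3 := fun i ↦ (M i * γ i) • v i with hpdef
  set MB : ℝ := ∑ i ∈ s, M i with hMBdef
  set P : E3 := ∑ i ∈ s, p i with hPdef
  set S : ℝ := √(MB ^ 2 + ‖P‖ ^ 2) with hSdef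
  set Γ : ℝ := (√(1 - k ^ 2))⁻¹ with hΓdef
  have hMB0 : 0 < MB := Finset.sum_pos hM hs
  have hv1 : ∀ i ∈ s, ‖v i‖ < 1 := fun i hi ↦ (hv i hi).trans_lt hk1
  have hk2 : 0 < 1 - k ^ 2 := by nlinarith
  have hΓ1 : 1 ≤ Γ := one_le_inv_sqrt_one_sub_sq' (by nlinarith : k ^ 2 < 1)
  have hΓ0 : 0 < Γ := one_pos.trans_le hΓ1
  -- `1 ≤ γᵢ ≤ Γ`
  have hγ1 : ∀ i ∈ s, 1 ≤ γ i := fun i hi ↦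
    one_le_inv_sqrt_one_sub_sq' (by nlinarith [hv1 i hi, norm_nonneg (v i)] : ‖v i‖ ^ 2 < 1)
  have hγΓ : ∀ i ∈ s, γ i ≤ Γ := by
    intro i hi
    have h1 : 0 < 1 - ‖v i‖ ^ 2 := by nlinarith [hv1 i hi, norm_nonneg (v i)]
    have hle : 1 - k ^ 2 ≤ 1 - ‖v i‖ ^ 2 := by nlinarith [hv i hi, norm_nonneg (v i)]
    exact inv_anti₀ (Real.sqrt_pos.mpr hk2) (Real.sqrt_le_sqrt hle)
  have hγ0 : ∀ i ∈ s, 0 < γ i := fun i hi ↦ one_pos.trans_le (hγ1 i hi)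
  -- energies of the members and their sum
  have hEi : ∀ i ∈ s, √((M i) ^ 2 + ‖p i‖ ^ 2) = M i * γ i := fun i hi ↦
    sqrt_sq_add_norm_lorentzMomentum (hM i hi).le (hv1 i hi)
  have hE : ∑ i ∈ s, √((M i) ^ 2 + ‖p i‖ ^ 2) = ∑ i ∈ s, M i * γ i := Finset.sum_congr rfl hEi
  -- the cold velocity and the cold momenta
  obtain ⟨hVlt, hVmom⟩ := lorentzMomentum_coldVelocity hMB0 P
  set V : E3 := S⁻¹ • P with hVdef
  have hpbar : (M j / MB) • P = (M j * (√(1 - ‖V‖ ^ 2))⁻¹) • V := by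
    rw [← smul_smul, hVmom, smul_smul, div_eq_mul_inv]
  -- internal energy dominates the `j`-th term
  have hK := internalEnergy_ge' s M p hM hs
  have hterm_nonneg : ∀ i ∈ s, 0 ≤ (M i) ^ 2 * ‖p i - (M i / MB) • P‖ ^ 2 /
      (2 * √((M i) ^ 2 + ‖p i‖ ^ 2) * (√((M i) ^ 2 + ‖(M i / MB) • P‖ ^ 2)) ^ 2) := fun i hi ↦ by positivity
  have hKj : (M j) ^ 2 * ‖p j - (M j / MB) • P‖ ^ 2 /
      (2 * √((M j) ^ 2 + ‖p j‖ ^ 2) * (√((M j) ^ 2 + ‖(M j / MB) • P‖ ^ 2)) ^ 2) ≤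
      ∑ i ∈ s, M i * γ i - S := by
    have h1 := Finset.single_le_sum hterm_nonneg hj
    rw [hE] at hK
    exact h1.trans hK
  -- bounds on the two energies in the denominator
  have hEj : √((M j) ^ 2 + ‖p j‖ ^ 2) = M j * γ j := hEi j hj
  have hEbar : √((M j) ^ 2 + ‖(M j / MB) • P‖ ^ 2) = M j / MB * S := sqrt_sq_add_norm_coldShare (hM j hj) hMB0 P
  have hS0 : 0 < S := Real.sqrt_pos.mpr (by positivity)
  have hKnonneg : 0 ≤ ∑ i ∈ s, M i * γ i - S := by
    have h0 := hterm_nonneg j hj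
    linarith
  have hSle : S ≤ Γ * MB := by
    have h1 : S ≤ ∑ i ∈ s, M i * γ i := by linarith
    have h2 : ∑ i ∈ s, M i * γ i ≤ ∑ i ∈ s, M i * Γ :=
      Finset.sum_le_sum fun i hi ↦ mul_le_mul_of_nonneg_left (hγΓ i hi) (hM i hi).le
    rw [← Finset.sum_mul] at h2
    linarith
  have hMj := hM j hj
  have hden1 : √((M j) ^ 2 + ‖p j‖ ^ 2) ≤ M j * Γ := by
    rw [hEj]; exact mul_le_mul_of_nonneg_left (hγΓ j hj) hMj.le
  have hden2 : √((M j) ^ 2 + ‖(M j / MB) • P‖ ^ 2) ≤ M j * Γ := by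
    rw [hEbar]
    calc M j / MB * S ≤ M j / MB * (Γ * MB) := mul_le_mul_of_nonneg_left hSle (div_pos hMj hMB0).le
      _ = M j * Γ := by field_simp
  have hden1pos : 0 < √((M j) ^ 2 + ‖p j‖ ^ 2) := by rw [hEj]; exact mul_pos hMj (hγ0 j hj)
  have hden2pos : 0 < √((M j) ^ 2 + ‖(M j / MB) • P‖ ^ 2) := by
    rw [hEbar]; exact mul_pos (div_pos hMj hMB0) hS0
  -- the numerator dominates `Mⱼ⁴‖vⱼ − V̂‖²`
  have hnum : (M j) ^ 2 * ‖v j - V‖ ^ 2 ≤ ‖p j - (M j / MB) • P‖ ^ 2 := by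
    have h1 : p j - (M j / MB) • P = M j • ((√(1 - ‖v j‖ ^ 2))⁻¹ • v j - (√(1 - ‖V‖ ^ 2))⁻¹ • V) := by
      rw [smul_sub, smul_smul, smul_smul, hpbar, sub_left_inj]
    have h2 := norm_sub_le_norm_lorentzMomentum_sub (hv1 j hj) hVlt
    rw [h1, norm_smul, Real.norm_eq_abs, abs_of_pos hMj, mul_pow]
    exact mul_le_mul_of_nonneg_left (pow_le_pow_left₀ (norm_nonneg _) h2 2) (sq_nonneg _)
  -- assemble: `Mⱼ‖vⱼ − V̂‖² ≤ 2Γ³ · (j-th term) ≤ 2Γ³ K`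
  have hstep : M j * ‖v j - V‖ ^ 2 ≤ 2 * Γ ^ 3 * ((M j) ^ 2 * ‖p j - (M j / MB) • P‖ ^ 2 /
      (2 * √((M j) ^ 2 + ‖p j‖ ^ 2) * (√((M j) ^ 2 + ‖(M j / MB) • P‖ ^ 2)) ^ 2)) := by
    rw [mul_div_assoc']
    rw [le_div_iff₀ (by positivity)]
    have hD : 2 * √((M j) ^ 2 + ‖p j‖ ^ 2) * (√((M j) ^ 2 + ‖(M j / MB) • P‖ ^ 2)) ^ 2 ≤
        2 * (M j * Γ) * (M j * Γ) ^ 2 := by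
      gcongr
    calc M j * ‖v j - V‖ ^ 2 * (2 * √((M j) ^ 2 + ‖p j‖ ^ 2) * (√((M j) ^ 2 + ‖(M j / MB) • P‖ ^ 2)) ^ 2)
        ≤ M j * ‖v j - V‖ ^ 2 * (2 * (M j * Γ) * (M j * Γ) ^ 2) :=
          mul_le_mul_of_nonneg_left hD (by positivity)
      _ = 2 * Γ ^ 3 * ((M j) ^ 2 * ((M j) ^ 2 * ‖v j - V‖ ^ 2)) := by ring
      _ ≤ 2 * Γ ^ 3 * ((M j) ^ 2 * ‖p j - (M j / MB) • P‖ ^ 2) := by gcongr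
  calc M j * ‖v j - V‖ ^ 2 ≤ _ := hstep
    _ ≤ 2 * Γ ^ 3 * (∑ i ∈ s, M i * γ i - S) := mul_le_mul_of_nonneg_left hKj (by positivity)

/-! ### The internal energy is 1-Lipschitz in the cluster 4-momentum -/

/-- `√(M² + ‖P‖²) ≤ √(M² + ‖Q‖²) + ‖P − Q‖`: the cold energy is 1-Lipschitz in the momentum. [folklore] -/
theorem sqrt_sq_add_norm_sq_le_add (M : ℝ) (P Q : E3) :
    √(M ^ 2 + ‖P‖ ^ 2) ≤ √(M ^ 2 + ‖Q‖ ^ 2) + ‖P - Q‖ := by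
  have hQ : 0 ≤ √(M ^ 2 + ‖Q‖ ^ 2) := Real.sqrt_nonneg _
  have hQ' : ‖Q‖ ≤ √(M ^ 2 + ‖Q‖ ^ 2) := by
    rw [Real.le_sqrt (norm_nonneg _) (by positivity)]
    nlinarith [sq_nonneg M]
  have hPQ : ‖P‖ ≤ ‖Q‖ + ‖P - Q‖ := by
    calc ‖P‖ = ‖Q + (P - Q)‖ := by rw [add_sub_cancel]
      _ ≤ ‖Q‖ + ‖P - Q‖ := norm_add_le _ _
  rw [Real.sqrt_le_left (by positivity)]
  have hsq : (√(M ^ 2 + ‖Q‖ ^ 2)) ^ 2 = M ^ 2 + ‖Q‖ ^ 2 := Real.sq_sqrt (by positivity)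
  nlinarith [norm_nonneg (P - Q), norm_nonneg P, norm_nonneg Q]

/-- **The internal energy is 1-Lipschitz in the cluster 4-momentum**: `|K(E,P) − K(E′,P′)| ≤ |E − E′| + ‖P − P′‖` for
`K(E,P) = E − √(M² + ‖P‖²)`. So on an admissible window path (energy and momentum sharp ± ζ) `K` is conserved up to the same
errors. [folklore] -/
theorem abs_internalEnergy_sub_le (M E E' : ℝ) (P P' : E3) :
    |(E - √(M ^ 2 + ‖P‖ ^ 2)) - (E' - √(M ^ 2 + ‖P'‖ ^ 2))| ≤ |E - E'| + ‖P - P'‖ := by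
  have h1 := sqrt_sq_add_norm_sq_le_add M P P'
  have h2 := sqrt_sq_add_norm_sq_le_add M P' P
  rw [norm_sub_rev] at h2
  rw [abs_le]
  constructor
  · linarith [neg_abs_le (E - E')]
  · linarith [le_abs_self (E - E')]

/-- Registered stub `mass_mul_norm_sub_coldVelocity_sq_le` (crux `stmt-FinalStateConjecture-10166`): small internal energy forces
every member velocity onto the cold velocity, one-line form of `mass_mul_norm_sub_coldVelocity_sq_le'`. [folklore] -/
theorem mass_mul_norm_sub_coldVelocity_sq_le : open Literature.Geometry.Lorentzian in ∀ {ι : Type*} (s : Finset ι) (M : ι → ℝ) (v : ι → E3) {k : ℝ}, (∀ i ∈ s, 0 < M i) → 0 ≤ k → k < 1 → (∀ i ∈ s, ‖v i‖ ≤ k) → ∀ {j : ι}, j ∈ s → M j * ‖v j - (√((∑ i ∈ s, M i) ^ 2 + ‖∑ i ∈ s, (M i * (√(1 - ‖v i‖ ^ 2))⁻¹) • v i‖ ^ 2))⁻¹ • ∑ i ∈ s, (M i * (√(1 - ‖v i‖ ^ 2))⁻¹) • v i‖ ^ 2 ≤ 2 * ((√(1 - k ^ 2))⁻¹) ^ 3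 * (∑ i ∈ s, M i * (√(1 - ‖v i‖ ^ 2))⁻¹ - √((∑ i ∈ s, M i) ^ 2 + ‖∑ i ∈ s, (M i * (√(1 - ‖v i‖ ^ 2))⁻¹) • v i‖ ^ 2)) :=
  fun s M v _ hM hk0 hk1 hv _ hj ↦ mass_mul_norm_sub_coldVelocity_sq_le' s M v hM hk0 hk1 hv hj

end Summit.FinalStateConjecture.FinalStateConjecture.Theorems.SublinearIsFree.Virial

end
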